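import Summits.AnomalousDissipation.AnomalousDissipation.Theorems.MomentParityQuarticGateKernel

/-!
# Cubic-row surgery for the crux `QuarticGate` (stmt-AnomalousDissipation-11464), line
# `dissipative-tower`, stub S7 `stub_cubicRowSurgery` — part I: the algebraic KERNEL

Pure finite-dimensional algebra + truncated moments (no fluid object). Data on `ℝⁿ`:

* three families of polynomials `R₀ i` (constants: the force rows `(f, bᵢ)`), `R₁ i` (linear: the
  viscous rows `ν (u, Δbᵢ)`), `R₂ i` (quadratic: the Euler rows `⟨B(u,u), bᵢ⟩`), so that the row of a
  polynomial test `P` is `L(Σᵢ ∂ᵢP · (R₀ i + R₁ i + R₂ i))`; write `F P`, `V P`, `E P` for the three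
  parts;
* a moment sequence `y` with `y 0 = 1`, strictly positive in degree `4` (Slater), all of whose
  QUADRATIC rows vanish (`hrow`, 3-stationarity);
* NO DISSIPATIVE TOWER (`hT`): a homogeneous cubic `Q` with `E Q = 0` (a Casimir) and
  `E P + V Q = 0` for some homogeneous quadratic `P` is zero.

Conclusion `exists_cubicShift`: a sequence `y'` with `y' 0 = 1`, strictly positive in degree `4`,
equal to `y` up to degree `2`, all of whose quadratic rows STILL vanish and, in addition, whose row
of every cubic Casimir vanishes. Construction: `y' = (y_{≤2}, y₃ + S, Λ·y_{≥4})` where the shift `S`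
of the third moments solves the finite linear system "`⟨S, E x^α⟩ = 0` (`|α| = 2`),
`⟨S, V Cᵢ⟩ = -L_y(F Cᵢ + V Cᵢ)` (`Cᵢ` a basis of the cubic Casimirs)"; by finite-dimensional duality
(`exists_eq_sum_mul_of_forall_sum_eq_zero`) it is solvable because a vanishing combination of the
left-hand sides is exactly a dissipative tower, excluded by `hT`; `Λ` from
`exists_forall_le_isStrictlyKPositive_shift`.
-/

-- `Summit.<Summit>.<Problem>` is the tree's mandated summit-side namespace (CONVENTIONS §2); for this
-- single-conjunct summit the two coincide, so the duplicate is deliberate.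
set_option linter.dupNamespace false

namespace Summit.AnomalousDissipation.AnomalousDissipation.Theorems.QuarticLadderQuarticGate

open scoped BigOperators
open MvPolynomial Literature.MeasureTheory.Moments
open Summit.AnomalousDissipation.AnomalousDissipation.Theorems.MomentParityQuarticGate

/-! ## Bookkeeping for the derivative forms `Σᵢ ∂ᵢP · Rᵢ` -/

/-- `P ↦ Σᵢ ∂ᵢP · Rᵢ` commutes with finite linear combinations. [folklore] -/
theorem sum_pderiv_mul_sum_smul {n : ℕ} {ι : Type*} (R : Fin n → MvPolynomial (Fin n) ℝ)
    (s : Finset ι) (w : ι → ℝ) (p : ι → MvPolynomial (Fin n) ℝ) :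
    (∑ i, pderiv i (∑ a ∈ s, w a • p a) * R i) = ∑ a ∈ s, w a • ∑ i, pderiv i (p a) * R i := by
  simp only [map_sum, Derivation.map_smul, Finset.sum_mul, smul_mul_assoc, Finset.smul_sum]
  exact Finset.sum_comm

/-- `P ↦ Σᵢ ∂ᵢP · Rᵢ` is additive. [folklore] -/
theorem sum_pderiv_mul_add {n : ℕ} (R : Fin n → MvPolynomial (Fin n) ℝ)
    (P Q : MvPolynomial (Fin n) ℝ) :
    (∑ i, pderiv i (P + Q) * R i) = (∑ i, pderiv i P * R i) + ∑ i, pderiv i Q * R i := by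
  simp only [map_add, add_mul, Finset.sum_add_distrib]

/-- `P ↦ Σᵢ ∂ᵢP · Rᵢ` is homogeneous. [folklore] -/
theorem sum_pderiv_mul_smul {n : ℕ} (R : Fin n → MvPolynomial (Fin n) ℝ) (c : ℝ)
    (P : MvPolynomial (Fin n) ℝ) :
    (∑ i, pderiv i (c • P) * R i) = c • ∑ i, pderiv i P * R i := by
  simp only [Derivation.map_smul, smul_mul_assoc, Finset.smul_sum]

/-- `Σᵢ ∂ᵢ0 · Rᵢ = 0`. [folklore] -/
theorem sum_pderiv_mul_zero {n : ℕ} (R : Fin n → MvPolynomial (Fin n) ℝ) :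
    (∑ i, pderiv i (0 : MvPolynomial (Fin n) ℝ) * R i) = 0 := by
  simp only [map_zero, zero_mul, Finset.sum_const_zero]

/-- Degree of `Σᵢ ∂ᵢP · Rᵢ` for homogeneous data. [folklore] -/
theorem isHomogeneous_sum_pderiv_mul {n d k : ℕ} {R : Fin n → MvPolynomial (Fin n) ℝ}
    {P : MvPolynomial (Fin n) ℝ} (hP : P.IsHomogeneous d) (hR : ∀ i, (R i).IsHomogeneous k) :
    (∑ i, pderiv i P * R i).IsHomogeneous (d - 1 + k) :=
  IsHomogeneous.sum _ _ _ fun i _ => hP.pderiv.mul (hR i)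

/-- A homogeneous polynomial all of whose coefficients of its own degree vanish is zero.
[folklore] -/
theorem eq_zero_of_isHomogeneous_of_coeff_eq_zero {n k : ℕ} {Q : MvPolynomial (Fin n) ℝ}
    (hQ : Q.IsHomogeneous k) (h : ∀ β : Fin n →₀ ℕ, β.degree = k → Q.coeff β = 0) : Q = 0 := by
  refine MvPolynomial.ext _ _ fun β => ?_
  rw [coeff_zero]
  by_cases hβ : β.degree = k
  · exact h β hβ
  · exact hQ.coeff_eq_zero hβ

/-- The degree-`3` part of a Riesz sum, rewritten as a sum over the degree-`3` exponents.
[folklore] -/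
theorem sum_support_degree_three_eq {n : ℕ} {T₃ : Finset (Fin n →₀ ℕ)}
    (hT₃ : ∀ α, α ∈ T₃ ↔ α.degree = 3) (s : ↥T₃ → ℝ) (Q : MvPolynomial (Fin n) ℝ) :
    (∑ β ∈ Q.support, if β.degree = 3 then
        Q.coeff β * (fun β => if h : β.degree = 3 then s ⟨β, (hT₃ β).mpr h⟩ else 0) β else 0) =
      ∑ β : ↥T₃, Q.coeff β.1 * s β := by
  classical
  rw [← Finset.sum_filter]
  have hsub : Q.support.filter (fun β => β.degree = 3) ⊆ T₃ := fun β hβ =>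
    (hT₃ β).mpr (Finset.mem_filter.mp hβ).2
  have hext : ∑ β ∈ Q.support.filter (fun β => β.degree = 3),
      Q.coeff β * (fun β => if h : β.degree = 3 then s ⟨β, (hT₃ β).mpr h⟩ else 0) β =
      ∑ β ∈ T₃, Q.coeff β * (fun β => if h : β.degree = 3 then s ⟨β, (hT₃ β).mpr h⟩ else 0) β := by
    refine Finset.sum_subset hsub fun β _ hβn => ?_
    have hcoeff : Q.coeff β = 0 := by
      by_contra hne
      exact hβn (Finset.mem_filter.mpr ⟨mem_support_iff.mpr hne, (hT₃ β).mp ‹β ∈ T₃›⟩)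
    rw [hcoeff, zero_mul]
  rw [hext, ← Finset.sum_coe_sort T₃]
  refine Finset.sum_congr rfl fun β _ => ?_
  obtain ⟨β, hβ⟩ := β
  have h3 : β.degree = 3 := (hT₃ β).mp hβ
  simp only [dif_pos h3]

/-- Coefficients above the total degree vanish (degree-`3` exponents of a polynomial of degree
`≤ 2`). [folklore] -/
theorem coeff_eq_zero_of_degree_three {n : ℕ} {Q : MvPolynomial (Fin n) ℝ} (hQ : Q.totalDegree ≤ 2)
    {β : Fin n →₀ ℕ} (hβ : β.degree = 3) : Q.coeff β = 0 := by
  refine coeff_eq_zero_of_totalDegree_lt ?_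
  have h := finsupp_degree_eq_sum β
  change Q.totalDegree < β.sum fun _ e => e
  omega

/-! ## The kernel: a second third-moment shift kills every cubic-Casimir row -/

/-- **KERNEL OF THE CUBIC-ROW SURGERY.** See the module docstring: from a Slater (`IsStrictlyKPositive`
in degree `4`) sequence `y` all of whose quadratic rows `L_y(Σᵢ ∂ᵢP (R₀ i + R₁ i + R₂ i))`
(`P` homogeneous quadratic) vanish, and the absence of dissipative towers, a sequence `y'`, equal to `y`
up to degree `2`, Slater in degree `4`, with vanishing quadratic rows AND vanishing rows of every cubic
Casimir (`Q` homogeneous cubic with `Σᵢ ∂ᵢQ · R₂ i = 0`). [folklore] -/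
theorem exists_cubicShift :
    ∀ {n : ℕ} (R₀ R₁ R₂ : Fin n → MvPolynomial (Fin n) ℝ), (∀ i, (R₀ i).IsHomogeneous 0) →
      (∀ i, (R₁ i).IsHomogeneous 1) → (∀ i, (R₂ i).IsHomogeneous 2) →
      ∀ (y : (Fin n →₀ ℕ) → ℝ), y 0 = 1 →
      Literature.MeasureTheory.Moments.IsStrictlyKPositive (Set.univ : Set (Fin n → ℝ)) 4 y →
      (∀ P Q : MvPolynomial (Fin n) ℝ, P.IsHomogeneous 2 → Q.IsHomogeneous 3 →
        (∑ i, MvPolynomial.pderiv i Q * R₂ i) = 0 →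
        (∑ i, MvPolynomial.pderiv i P * R₂ i) + (∑ i, MvPolynomial.pderiv i Q * R₁ i) = 0 →
        Q = 0) →
      (∀ P : MvPolynomial (Fin n) ℝ, P.IsHomogeneous 2 →
        Literature.MeasureTheory.Moments.rieszFunctional y
          (∑ i, MvPolynomial.pderiv i P * (R₀ i + R₁ i + R₂ i)) = 0) →
      ∃ y' : (Fin n →₀ ℕ) → ℝ, y' 0 = 1 ∧
        Literature.MeasureTheory.Moments.IsStrictlyKPositive (Set.univ : Set (Fin n → ℝ)) 4 y' ∧
        (∀ α : Fin n →₀ ℕ, α.degree ≤ 2 → y' α = y α) ∧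
        (∀ P : MvPolynomial (Fin n) ℝ, P.IsHomogeneous 2 →
          Literature.MeasureTheory.Moments.rieszFunctional y'
            (∑ i, MvPolynomial.pderiv i P * (R₀ i + R₁ i + R₂ i)) = 0) ∧
        (∀ Q : MvPolynomial (Fin n) ℝ, Q.IsHomogeneous 3 →
          (∑ i, MvPolynomial.pderiv i Q * R₂ i) = 0 →
          Literature.MeasureTheory.Moments.rieszFunctional y'
            (∑ i, MvPolynomial.pderiv i Q * (R₀ i + R₁ i + R₂ i)) = 0) := by
  intro n R₀ R₁ R₂ hR₀ hR₁ hR₂ y hy0 hypos hT hrow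
  classical
  -- (0) exponents of degree 2 and 3; the three parts of a row
  obtain ⟨T₂, hT₂⟩ := exists_finset_degree_eq n 2
  obtain ⟨T₃, hT₃⟩ := exists_finset_degree_eq n 3
  have hsplit : ∀ P : MvPolynomial (Fin n) ℝ, (∑ i, pderiv i P * (R₀ i + R₁ i + R₂ i)) =
      (∑ i, pderiv i P * R₀ i) + (∑ i, pderiv i P * R₁ i) + ∑ i, pderiv i P * R₂ i := fun P => by
    simp only [mul_add, Finset.sum_add_distrib]
  -- degrees
  have hF2 : ∀ P : MvPolynomial (Fin n) ℝ, P.IsHomogeneous 2 →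
      (∑ i, pderiv i P * R₀ i).IsHomogeneous 1 := fun P hP => isHomogeneous_sum_pderiv_mul hP hR₀
  have hV2 : ∀ P : MvPolynomial (Fin n) ℝ, P.IsHomogeneous 2 →
      (∑ i, pderiv i P * R₁ i).IsHomogeneous 2 := fun P hP => isHomogeneous_sum_pderiv_mul hP hR₁
  have hE2 : ∀ P : MvPolynomial (Fin n) ℝ, P.IsHomogeneous 2 →
      (∑ i, pderiv i P * R₂ i).IsHomogeneous 3 := fun P hP => isHomogeneous_sum_pderiv_mul hP hR₂
  have hF3 : ∀ Q : MvPolynomial (Fin n) ℝ, Q.IsHomogeneous 3 →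
      (∑ i, pderiv i Q * R₀ i).IsHomogeneous 2 := fun Q hQ => isHomogeneous_sum_pderiv_mul hQ hR₀
  have hV3 : ∀ Q : MvPolynomial (Fin n) ℝ, Q.IsHomogeneous 3 →
      (∑ i, pderiv i Q * R₁ i).IsHomogeneous 3 := fun Q hQ => isHomogeneous_sum_pderiv_mul hQ hR₁
  -- (1) the cubic Casimirs: a finite-dimensional subspace, with a finite basis `Cv`
  set W : Submodule ℝ (MvPolynomial (Fin n) ℝ) := homogeneousSubmodule (Fin n) ℝ 3 with hW
  haveI : FiniteDimensional ℝ ↥W := Module.Finite.iff_fg.mpr (homogeneousSubmodule_fg (Fin n) ℝ 3)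
  set EL : MvPolynomial (Fin n) ℝ →ₗ[ℝ] MvPolynomial (Fin n) ℝ :=
    { toFun := fun P => ∑ i, pderiv i P * R₂ i
      map_add' := fun P Q => sum_pderiv_mul_add R₂ P Q
      map_smul' := fun c P => sum_pderiv_mul_smul R₂ c P } with hEL
  have hELapply : ∀ P, EL P = ∑ i, pderiv i P * R₂ i := fun P => rfl
  set Cas : Submodule ℝ (MvPolynomial (Fin n) ℝ) := W ⊓ LinearMap.ker EL with hCas
  haveI : FiniteDimensional ℝ ↥Cas := Submodule.finiteDimensional_of_le inf_le_left
  set bC := Module.finBasis ℝ ↥Cas with hbC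
  set Cv : Fin (Module.finrank ℝ ↥Cas) → MvPolynomial (Fin n) ℝ := fun i => (bC i : MvPolynomial (Fin n) ℝ)
    with hCv
  have hmemCas : ∀ Q : MvPolynomial (Fin n) ℝ, Q ∈ Cas ↔ Q.IsHomogeneous 3 ∧ (∑ i, pderiv i Q * R₂ i) = 0 :=
    fun Q => by
      rw [hCas, Submodule.mem_inf, hW, mem_homogeneousSubmodule, LinearMap.mem_ker, hELapply]
  have hCv3 : ∀ i, (Cv i).IsHomogeneous 3 := fun i => ((hmemCas _).mp (bC i).2).1
  have hCvE : ∀ i, (∑ j, pderiv j (Cv i) * R₂ j) = 0 := fun i => ((hmemCas _).mp (bC i).2).2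
  -- (2) the linear system for the shift: rows indexed by `T₂ ⊕ basis`, columns by `T₃`
  set c' : (↥T₂ ⊕ Fin (Module.finrank ℝ ↥Cas)) → ↥T₃ → ℝ := fun a β =>
    Sum.elim (fun α : ↥T₂ => ((∑ i, pderiv i (monomial α.1 (1 : ℝ)) * R₂ i).coeff β.1))
      (fun i => (∑ j, pderiv j (Cv i) * R₁ j).coeff β.1) a with hc'
  set a' : (↥T₂ ⊕ Fin (Module.finrank ℝ ↥Cas)) → ℝ :=
    Sum.elim (fun _ => (0 : ℝ))
      (fun i => -rieszFunctional y (∑ j, pderiv j (Cv i) * (R₀ j + R₁ j + R₂ j))) with ha'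
  have hker : ∀ p : (↥T₂ ⊕ Fin (Module.finrank ℝ ↥Cas)) → ℝ, (∀ β, ∑ a, p a * c' a β = 0) →
      ∑ a, p a * a' a = 0 := by
    intro p hp
    set P : MvPolynomial (Fin n) ℝ := ∑ α : ↥T₂, p (Sum.inl α) • monomial α.1 (1 : ℝ) with hPdef
    set Q : MvPolynomial (Fin n) ℝ := ∑ i, p (Sum.inr i) • Cv i with hQdef
    have hP : P.IsHomogeneous 2 := IsHomogeneous.sum _ _ _ fun α _ => by
      rw [smul_monomial, smul_eq_mul, mul_one]
      exact isHomogeneous_monomial _ ((hT₂ α.1).mp α.2)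
    have hQ : Q.IsHomogeneous 3 := IsHomogeneous.sum _ _ _ fun i _ => by
      rw [smul_eq_C_mul]
      simpa using (isHomogeneous_C (Fin n) (p (Sum.inr i))).mul (hCv3 i)
    have hEQ : (∑ j, pderiv j Q * R₂ j) = 0 := by
      rw [hQdef, sum_pderiv_mul_sum_smul]
      exact Finset.sum_eq_zero fun i _ => by rw [hCvE i, smul_zero]
    have hEP : (∑ j, pderiv j P * R₂ j) = ∑ α : ↥T₂, p (Sum.inl α) •
        ∑ j, pderiv j (monomial α.1 (1 : ℝ)) * R₂ j := by
      rw [hPdef, sum_pderiv_mul_sum_smul]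
    have hVQ : (∑ j, pderiv j Q * R₁ j) = ∑ i, p (Sum.inr i) • ∑ j, pderiv j (Cv i) * R₁ j := by
      rw [hQdef, sum_pderiv_mul_sum_smul]
    -- the relation says: `E P + V Q = 0`
    have hrel : (∑ j, pderiv j P * R₂ j) + (∑ j, pderiv j Q * R₁ j) = 0 := by
      refine eq_zero_of_isHomogeneous_of_coeff_eq_zero ((hE2 P hP).add (hV3 Q hQ)) fun β hβ => ?_
      have h := hp ⟨β, (hT₃ β).mpr hβ⟩
      rw [Fintype.sum_sum_type] at h
      simp only [hc', Sum.elim_inl, Sum.elim_inr] at h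
      rw [coeff_add, hEP, hVQ, coeff_sum, coeff_sum]
      simp only [coeff_smul, smul_eq_mul]
      exact h
    -- hence (no tower) `Q = 0`, and the right-hand side pairs to `-L_y(row Q) = 0`
    have hQ0 : Q = 0 := hT P Q hP hQ hEQ hrel
    have hrowQ : ∑ i, p (Sum.inr i) * rieszFunctional y (∑ j, pderiv j (Cv i) * (R₀ j + R₁ j + R₂ j)) =
        rieszFunctional y (∑ j, pderiv j Q * (R₀ j + R₁ j + R₂ j)) := by
      rw [hQdef, sum_pderiv_mul_sum_smul, rieszFunctional_sum_smul]
    rw [Fintype.sum_sum_type]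
    simp only [ha', Sum.elim_inl, Sum.elim_inr, mul_zero, Finset.sum_const_zero, zero_add, mul_neg,
      Finset.sum_neg_distrib, hrowQ, hQ0, sum_pderiv_mul_zero, neg_eq_zero]
    simp [rieszFunctional]
  obtain ⟨s, hs⟩ := exists_eq_sum_mul_of_forall_sum_eq_zero c' a' hker
  -- the two families of equations, unpacked
  have hsQ : ∀ α : ↥T₂, ∑ β : ↥T₃, (∑ i, pderiv i (monomial α.1 (1 : ℝ)) * R₂ i).coeff β.1 * s β = 0 :=
    fun α => by
      have h := hs (Sum.inl α)
      simp only [ha', hc', Sum.elim_inl] at h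
      exact h.symm
  have hsC : ∀ i, ∑ β : ↥T₃, (∑ j, pderiv j (Cv i) * R₁ j).coeff β.1 * s β =
      -rieszFunctional y (∑ j, pderiv j (Cv i) * (R₀ j + R₁ j + R₂ j)) := fun i => by
    have h := hs (Sum.inr i)
    simp only [ha', hc', Sum.elim_inr] at h
    exact h.symm
  -- (3) the shift and the inflation
  set S : (Fin n →₀ ℕ) → ℝ := fun β => if h : β.degree = 3 then s ⟨β, (hT₃ β).mpr h⟩ else 0 with hSdef
  obtain ⟨Λ₀, hΛ⟩ := exists_forall_le_isStrictlyKPositive_shift n y S hypos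
  set y' : (Fin n →₀ ℕ) → ℝ := fun α =>
    if α.degree ≤ 2 then y α else if α.degree = 3 then y α + S α else Λ₀ * y α with hy'
  have hy'2 : ∀ α : Fin n →₀ ℕ, α.degree ≤ 2 → y' α = y α := fun α hα => by simp [hy', hα]
  -- `L_{y'}` of a polynomial of degree `≤ 3`: `L_y` plus the pairing of its cubic part with `s`
  have hshift : ∀ Qr : MvPolynomial (Fin n) ℝ, Qr.totalDegree ≤ 3 →
      rieszFunctional y' Qr = rieszFunctional y Qr + ∑ β : ↥T₃, Qr.coeff β.1 * s β := by
    intro Qr hQr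
    rw [rieszFunctional_eq_of_degree_three y' y S (fun β hβ => hy'2 β (by omega))
      (fun β hβ => by simp [hy', hβ]) Qr hQr, sum_support_degree_three_eq hT₃ s Qr]
  refine ⟨y', by simp [hy', hy0], hΛ Λ₀ le_rfl, hy'2, fun P hP => ?_, fun Q hQ hQE => ?_⟩
  · -- (4) quadratic rows still vanish
    have hdeg : (∑ i, pderiv i P * (R₀ i + R₁ i + R₂ i)).totalDegree ≤ 3 := by
      rw [hsplit]
      refine (totalDegree_add _ _).trans (max_le ((totalDegree_add _ _).trans (max_le ?_ ?_)) ?_)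
      · exact (hF2 P hP).totalDegree_le.trans (by norm_num)
      · exact (hV2 P hP).totalDegree_le.trans (by norm_num)
      · exact (hE2 P hP).totalDegree_le
    rw [hshift _ hdeg, hrow P hP, zero_add]
    -- only the Euler part has cubic coefficients, and it pairs to zero with `s`
    have hcoeff : ∀ β : ↥T₃, (∑ i, pderiv i P * (R₀ i + R₁ i + R₂ i)).coeff β.1 =
        (∑ i, pderiv i P * R₂ i).coeff β.1 := fun β => by
      have h3 : β.1.degree = 3 := (hT₃ β.1).mp β.2
      rw [hsplit, coeff_add, coeff_add,
        coeff_eq_zero_of_degree_three ((hF2 P hP).totalDegree_le.trans (by norm_num)) h3,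
        coeff_eq_zero_of_degree_three (hV2 P hP).totalDegree_le h3, zero_add, zero_add]
    simp_rw [hcoeff]
    rw [eq_sum_smul_monomial_of_isHomogeneous hT₂ P hP, sum_pderiv_mul_sum_smul]
    simp_rw [coeff_sum, coeff_smul, smul_eq_mul, Finset.sum_mul, mul_assoc]
    rw [Finset.sum_comm]
    refine Finset.sum_eq_zero fun α _ => ?_
    rw [← Finset.mul_sum, hsQ α, mul_zero]
  · -- (5) cubic-Casimir rows vanish
    have hQmem : Q ∈ Cas := (hmemCas Q).mpr ⟨hQ, hQE⟩
    -- expand `Q` in the basis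
    have hQsum : Q = ∑ i, (bC.repr ⟨Q, hQmem⟩ i) • Cv i := by
      have h := bC.sum_repr ⟨Q, hQmem⟩
      have h' := congrArg Subtype.val h
      rw [Submodule.coe_sum] at h'
      simp only [Submodule.coe_smul] at h'
      exact h'.symm
    have hrowi : ∀ i, rieszFunctional y' (∑ j, pderiv j (Cv i) * (R₀ j + R₁ j + R₂ j)) = 0 := by
      intro i
      have hdeg : (∑ j, pderiv j (Cv i) * (R₀ j + R₁ j + R₂ j)).totalDegree ≤ 3 := by
        rw [hsplit, hCvE i, add_zero]
        refine (totalDegree_add _ _).trans (max_le ?_ ?_)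
        · exact (hF3 _ (hCv3 i)).totalDegree_le.trans (by norm_num)
        · exact (hV3 _ (hCv3 i)).totalDegree_le
      have hcoeff : ∀ β : ↥T₃, (∑ j, pderiv j (Cv i) * (R₀ j + R₁ j + R₂ j)).coeff β.1 =
          (∑ j, pderiv j (Cv i) * R₁ j).coeff β.1 := fun β => by
        have h3 : β.1.degree = 3 := (hT₃ β.1).mp β.2
        rw [hsplit, hCvE i, add_zero, coeff_add,
          coeff_eq_zero_of_degree_three (hF3 _ (hCv3 i)).totalDegree_le h3, zero_add]
      rw [hshift _ hdeg]
      simp_rw [hcoeff]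
      rw [hsC i]
      ring
    rw [hQsum, sum_pderiv_mul_sum_smul, rieszFunctional_sum_smul]
    exact Finset.sum_eq_zero fun i _ => by rw [hrowi i, mul_zero]

end Summit.AnomalousDissipation.AnomalousDissipation.Theorems.QuarticLadderQuarticGate
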